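import Summits.QuantumAdvantage.QuantumAdvantage.Theorems.CharDialPrefixFaceB
import HarnessLib
import Summits.QuantumAdvantage.AdviceFreeQNC0.FixedBellsDense

/-!
# The prefix face of `WalkHardFJLinOdd` closes: `prefixForm_hard_unif` (decomp-qadv lens-6 g16, tree part 29)

**Theorem** (`JLinPeel.prefixForm_hard_unif`, every `p` with `p % 3 ≠ 0` — all primes `p ≠ 3`
(`prefixForm_hard_unif_prime`), every charge `c`): a strategy of the `n+1` cuts of the form `h_g(u|_{J_g}, t_g·W_{<g}(u))` — a
`log₂ n`-JUNTA composed with a PREFIX COUNTER mod `p` — wins the odd-`n` parity⊕mod-3 relation on at most `θ·2ⁿ` inputs,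
`θ = 1 − 2^{−(4p+2)}`, once `n ≥ 2^{6(4p+2)+10}`; `suffixForm_hard_unif` is the SUFFIX-counter face (`t_g·W_{≥g}`) by the landed
time reversal (`CharDialReversal`).  This supersedes the one-read rung `prefixOneRead_hard_unif` (part 28, `|J_g| ≤ 1`) in the
junta parameter; `3 ∣ p` is genuinely excluded (the counter mod 3 reads the walk label).

Proof (parts 29A, 29B): inside a one-read set `S` of exactly `4p+2` free positions (`oneReadRich`) choose thresholds by the
discrete IVT (`Nf_hits`) cutting `S` into six BLOCKS of sizes `(p,p,1,p,p,1)` and plant the 25-point design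
`x_{(i,k)} = pat(i) ⊔ pat(k)` (`dpt`); below every cut the free prefix count of `x_{(i,k)}` is `AA_j(i,k)` and its weight is
`TT(i)+TT(k)` up to frozen constants (`wtPrefix_dpt_eq`, `W6_eq_AA`), so the class counts of `even_fired_live` are the sums
certified even by `certF` (`design_bal`); the parity principle gives a loser in every fibre (`noPerfectOneRead_cert`) and the
dial `winBound_of_noPerfect` the bound.  Kernel-closed; no `decide`/`native_decide`.
-/

set_option linter.dupNamespace false
set_option autoImplicit false

namespace Summit.QuantumAdvantage.AdviceFreeQNC0.JLinPeel

open Finset AffBells22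

namespace PrefixFace

/-! ### THE DESIGN INSIDE A ONE-READ SUBCUBE -/

section Design

variable {n : ℕ}

/-- number of positions of `S` below `h`. -/
def Nf (S : Finset (Fin n)) (h : ℕ) : ℕ := (S.filter fun s => s.val < h).card

/-- `CharDialPrefixFace` helper (decomp-qadv land package, lens-6 g16; see the module docstring). -/
theorem Nf_mono (S : Finset (Fin n)) {h₁ h₂ : ℕ} (hh : h₁ ≤ h₂) : Nf S h₁ ≤ Nf S h₂ :=
  card_le_card fun s hs => by
    rw [mem_filter] at hs ⊢
    exact ⟨hs.1, lt_of_lt_of_le hs.2 hh⟩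

/-- `CharDialPrefixFace` helper (decomp-qadv land package, lens-6 g16; see the module docstring). -/
theorem Nf_zero (S : Finset (Fin n)) : Nf S 0 = 0 := by simp [Nf]

/-- `CharDialPrefixFace` helper (decomp-qadv land package, lens-6 g16; see the module docstring). -/
theorem Nf_card (S : Finset (Fin n)) {h : ℕ} (hh : n ≤ h) : Nf S h = S.card := by
  unfold Nf; congr 1; exact filter_true_of_mem fun s _ => lt_of_lt_of_le s.isLt hh

/-- `CharDialPrefixFace` helper (decomp-qadv land package, lens-6 g16; see the module docstring). -/
theorem Nf_succ (S : Finset (Fin n)) (h : ℕ) : Nf S (h + 1) ≤ Nf S h + 1 := by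
  classical
  unfold Nf
  have hsub : S.filter (fun s => s.val < h + 1) ⊆ S.filter (fun s => s.val < h) ∪ S.filter (fun s => s.val = h) := by
    intro s hs
    rw [mem_filter] at hs
    rw [mem_union, mem_filter, mem_filter]
    rcases Nat.lt_succ_iff_lt_or_eq.mp hs.2 with h' | h'
    · exact Or.inl ⟨hs.1, h'⟩
    · exact Or.inr ⟨hs.1, h'⟩
  have h1 : (S.filter fun s => s.val = h).card ≤ 1 :=
    card_le_one.mpr fun a ha b hb => Fin.ext (by rw [(mem_filter.mp ha).2, (mem_filter.mp hb).2])
  exact (card_le_card hsub).trans ((card_union_le _ _).trans (by omega))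

/-- discrete intermediate values of the free count. -/
theorem Nf_hits (S : Finset (Fin n)) : ∀ H m : ℕ, m ≤ Nf S H → ∃ h ≤ H, Nf S h = m := by
  intro H
  induction H with
  | zero => intro m hm; refine ⟨0, le_rfl, ?_⟩; rw [Nf_zero] at hm ⊢; omega
  | succ H ih =>
    intro m hm
    by_cases h' : m ≤ Nf S H
    · obtain ⟨h, hh, e⟩ := ih m h'; exact ⟨h, hh.trans (Nat.le_succ _), e⟩
    · exact ⟨H + 1, le_rfl, by have := Nf_succ S H; omega⟩

/-- `CharDialPrefixFace` helper (decomp-qadv land package, lens-6 g16; see the module docstring). -/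
theorem Nf_min (S : Finset (Fin n)) (h g : ℕ) : Nf S (min h g) = min (Nf S h) (Nf S g) := by
  rcases le_total h g with hg | hg
  · rw [min_eq_left hg, min_eq_left (Nf_mono S hg)]
  · rw [min_eq_right hg, min_eq_right (Nf_mono S hg)]

/-- block starts in free order: `0, p, 2p, 2p+1, 3p+1, 4p+1, 4p+2` (blocks of sizes `p,p,1,p,p,1`). -/
def st (p : ℕ) : ℕ → ℕ
  | 0 => 0
  | 1 => p
  | 2 => 2 * p
  | 3 => 2 * p + 1
  | 4 => 3 * p + 1
  | 5 => 4 * p + 1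
  | 6 => 4 * p + 2
  | _ => 4 * p + 2

/-- block of a position w.r.t. position thresholds `G 1 ≤ … ≤ G 5`. -/
def blkOf (G : ℕ → ℕ) (s : Fin n) : ℕ :=
  if s.val < G 1 then 0 else if s.val < G 2 then 1 else if s.val < G 3 then 2 else if s.val < G 4 then 3
    else if s.val < G 5 then 4 else 5

/-- `CharDialPrefixFace` helper (decomp-qadv land package, lens-6 g16; see the module docstring). -/
theorem blkOf_lt (G : ℕ → ℕ) (s : Fin n) : blkOf G s < 6 := by unfold blkOf; split_ifs <;> omega

/-- `CharDialPrefixFace` helper (decomp-qadv land package, lens-6 g16; see the module docstring). -/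
theorem blkOf_eq_iff (G : ℕ → ℕ) (hG0 : G 0 = 0) (hGmono : ∀ k ≤ 5, G k ≤ G (k + 1)) (hG6 : G 6 = n) (s : Fin n)
    (k : ℕ) (hk : k < 6) : blkOf G s = k ↔ G k ≤ s.val ∧ s.val < G (k + 1) := by
  have h01 := hGmono 0 (by norm_num); have h12 := hGmono 1 (by norm_num); have h23 := hGmono 2 (by norm_num)
  have h34 := hGmono 3 (by norm_num); have h45 := hGmono 4 (by norm_num); have h56 := hGmono 5 (by norm_num)
  simp only [Nat.reduceAdd] at h01 h12 h23 h34 h45 h56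
  rw [hG0] at h01
  rw [hG6] at h56
  have hs := s.isLt
  unfold blkOf
  interval_cases k <;> simp only [Nat.reduceAdd, hG0, hG6] <;> split_ifs <;> constructor <;> intro hh <;>
    (try obtain ⟨hh1, hh2⟩ := hh) <;> omega

/-- number of free positions of block `k` below `h`. -/
def cnt (S : Finset (Fin n)) (G : ℕ → ℕ) (k h : ℕ) : ℕ := (S.filter fun s => s.val < h ∧ blkOf G s = k).card

/-- `CharDialPrefixFace` helper (decomp-qadv land package, lens-6 g16; see the module docstring). -/
theorem cnt_eq (S : Finset (Fin n)) (G : ℕ → ℕ) (hG0 : G 0 = 0) (hGmono : ∀ k ≤ 5, G k ≤ G (k + 1)) (hG6 : G 6 = n)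
    (k : ℕ) (hk : k < 6) (h : ℕ) : cnt S G k h = Nf S (min h (G (k + 1))) - Nf S (min h (G k)) := by
  classical
  have hGk : G k ≤ G (k + 1) := hGmono k (by omega)
  unfold cnt Nf
  have hset : (S.filter fun s => s.val < h ∧ blkOf G s = k)
      = (S.filter fun s => s.val < min h (G (k + 1))) \ (S.filter fun s => s.val < min h (G k)) := by
    ext s
    rw [mem_sdiff, mem_filter, mem_filter, mem_filter, blkOf_eq_iff G hG0 hGmono hG6 s k hk]
    constructor
    · rintro ⟨hs, h1, h2, h3⟩
      exact ⟨⟨hs, lt_min h1 h3⟩, fun ⟨_, h4⟩ => by have := lt_min_iff.mp h4; omega⟩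
    · rintro ⟨⟨hs, h1⟩, h2⟩
      have h1' := lt_min_iff.mp h1
      refine ⟨hs, h1'.1, ?_, h1'.2⟩
      by_contra h3
      exact h2 ⟨hs, lt_min h1'.1 (by omega)⟩
  rw [hset, card_sdiff_of_subset]
  intro s hs
  rw [mem_filter] at hs ⊢
  exact ⟨hs.1, lt_of_lt_of_le hs.2 (min_le_min_left h hGk)⟩

/-- the 25 design points: block pattern on `S`, frozen to `b` off `S`. -/
def dpt (S : Finset (Fin n)) (b : Fin n → Bool) (G : ℕ → ℕ) (p : ℕ) (ik : Fin 5 × Fin 5) : Fin n → Bool :=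
  fun s => if s ∈ S then bit6 p ik (blkOf G s) else b s

/-- frozen ones below `h`. -/
def Bfro (S : Finset (Fin n)) (b : Fin n → Bool) (h : ℕ) : ℕ :=
  (univ.filter fun i : Fin n => i ∉ S ∧ (i.val < h ∧ b i = true)).card

/-- `CharDialPrefixFace` helper (decomp-qadv land package, lens-6 g16; see the module docstring). -/
theorem wtPrefix_dpt (S : Finset (Fin n)) (b : Fin n → Bool) (G : ℕ → ℕ) (p : ℕ) (ik : Fin 5 × Fin 5) (h : ℕ) :
    wtPrefix (dpt S b G p ik) h = Bfro S b h + ∑ k ∈ range 6, (if bit6 p ik k = true then cnt S G k h else 0) := by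
  classical
  unfold wtPrefix Bfro cnt
  rw [← Finset.card_filter_add_card_filter_not
    (s := (univ : Finset (Fin n)).filter fun i => i.val < h ∧ dpt S b G p ik i = true) (fun i => i ∉ S)]
  congr 1
  · congr 1
    ext i
    simp only [mem_filter, mem_univ, true_and]
    constructor
    · rintro ⟨⟨h1, h2⟩, h3⟩
      refine ⟨h3, h1, ?_⟩
      simpa [dpt, h3] using h2
    · rintro ⟨h3, h1, h2⟩
      exact ⟨⟨h1, by simpa [dpt, h3] using h2⟩, h3⟩
  · rw [card_eq_sum_card_fiberwise (f := blkOf G) (t := range 6) (fun i _ => mem_range.mpr (blkOf_lt G i))]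
    refine sum_congr rfl fun k _ => ?_
    by_cases hb : bit6 p ik k = true
    · rw [if_pos hb]
      congr 1
      ext s
      simp only [mem_filter, mem_univ, true_and, not_not]
      constructor
      · rintro ⟨⟨⟨h1, _⟩, h3⟩, h4⟩; exact ⟨h3, h1, h4⟩
      · rintro ⟨h3, h1, h4⟩
        refine ⟨⟨⟨h1, ?_⟩, h3⟩, h4⟩
        simp only [dpt, if_pos h3, h4, hb]
    · rw [if_neg hb, card_eq_zero, filter_eq_empty_iff]
      rintro s hs h4
      simp only [mem_filter, mem_univ, true_and, not_not] at hs
      obtain ⟨⟨_, h2⟩, h3⟩ := hs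
      simp only [dpt, if_pos h3, h4] at h2
      exact hb h2

/-- free prefix count of the 6-block pattern, block-sum form. -/
def W6 (p j : ℕ) (ik : Fin 5 × Fin 5) : ℕ :=
  ∑ k ∈ range 6, if bit6 p ik k = true then min j (st p (k + 1)) - min j (st p k) else 0

/-- `CharDialPrefixFace` helper (decomp-qadv land package, lens-6 g16; see the module docstring). -/
theorem bit6_val (p : ℕ) (ik : Fin 5 × Fin 5) : bit6 p ik 0 = pat p ik.1 0 ∧ bit6 p ik 1 = pat p ik.1 1 ∧ bit6 p ik 2 = pat p ik.1 2
    ∧ bit6 p ik 3 = pat p ik.2 0 ∧ bit6 p ik 4 = pat p ik.2 1 ∧ bit6 p ik 5 = pat p ik.2 2 := by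
  simp [bit6]

/-- `CharDialPrefixFace` helper (decomp-qadv land package, lens-6 g16; see the module docstring). -/
theorem W6_eq_AA {p j : ℕ} (hj : j ≤ 4 * p + 2) (ik : Fin 5 × Fin 5) : W6 p j ik = AA p j ik := by
  obtain ⟨b0, b1, b2, b3, b4, b5⟩ := bit6_val p ik
  simp only [W6, sum_range_succ, sum_range_zero, zero_add, Nat.reduceAdd, st, b0, b1, b2, b3, b4, b5]
  unfold AA
  by_cases hjm : j ≤ 2 * p + 1
  · rw [if_pos hjm]
    have e0 : min j 0 = 0 := Nat.min_zero j
    have e2 : min j (2 * p + 1) = j := min_eq_left hjm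
    have e3 : min j (3 * p + 1) = j := min_eq_left (by omega)
    have e4 : min j (4 * p + 1) = j := min_eq_left (by omega)
    have e5 : min j (4 * p + 2) = j := min_eq_left (by omega)
    simp only [e0, e2, e3, e4, e5, Nat.sub_zero, Nat.sub_self, ite_self, add_zero]
    rfl
  · rw [if_neg hjm]
    have e0 : min j 0 = 0 := Nat.min_zero j
    have e1 : min j p = p := min_eq_right (by omega)
    have e2 : min j (2 * p) = 2 * p := min_eq_right (by omega)
    have e3 : min j (2 * p + 1) = 2 * p + 1 := min_eq_right (by omega)
    have h1 : 2 * p - p = p := by omega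
    have h2 : 2 * p + 1 - 2 * p = 1 := by omega
    have h3 : min j (3 * p + 1) - (2 * p + 1) = min (j - (2 * p + 1)) p := by omega
    have h4 : min j (4 * p + 1) - min j (3 * p + 1) = min (j - (2 * p + 1)) (2 * p) - min (j - (2 * p + 1)) p := by omega
    have h5 : min j (4 * p + 2) - min j (4 * p + 1) = (j - (2 * p + 1)) - min (j - (2 * p + 1)) (2 * p) := by omega
    simp only [e0, e1, e2, e3, Nat.sub_zero, h1, h2, h3, h4, h5]
    simp only [TT, aA]
    ring

/-- `CharDialPrefixFace` helper (decomp-qadv land package, lens-6 g16; see the module docstring). -/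
theorem AA_top (p : ℕ) (ik : Fin 5 × Fin 5) : AA p (4 * p + 2) ik = TT p ik.1 + TT p ik.2 := by
  unfold AA
  rw [if_neg (by omega), show 4 * p + 2 - (2 * p + 1) = 2 * p + 1 by omega, aA_full]

/-- `CharDialPrefixFace` helper (decomp-qadv land package, lens-6 g16; see the module docstring). -/
theorem wtPrefix_dpt_eq (S : Finset (Fin n)) (b : Fin n → Bool) (G : ℕ → ℕ) (p : ℕ) (hG0 : G 0 = 0)
    (hGmono : ∀ k ≤ 5, G k ≤ G (k + 1)) (hG6 : G 6 = n) (hGst : ∀ k ≤ 6, Nf S (G k) = st p k) (ik : Fin 5 × Fin 5)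
    (h : ℕ) : wtPrefix (dpt S b G p ik) h = Bfro S b h + W6 p (Nf S h) ik := by
  rw [wtPrefix_dpt]
  unfold W6
  congr 1
  refine sum_congr rfl fun k hk => ?_
  have hk6 := mem_range.mp hk
  rw [cnt_eq S G hG0 hGmono hG6 k hk6 h, Nf_min, Nf_min, hGst (k + 1) (by omega), hGst k (by omega)]

/-- **the design is class-balanced at every cut** (reduction to `certF`). -/
theorem design_bal {p : ℕ} (hp : p % 3 ≠ 0) (S : Finset (Fin n)) (b : Fin n → Bool) (G : ℕ → ℕ) (hG0 : G 0 = 0)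
    (hGmono : ∀ k ≤ 5, G k ≤ G (k + 1)) (hG6 : G 6 = n) (hGst : ∀ k ≤ 6, Nf S (G k) = st p k)
    (g : Fin (n + 1)) (i₀ : Fin n) (hi₀ : i₀ ∈ S) (v : Bool) (w e : ℕ) (he : e < 3) :
    Even ((univ.filter fun ik : Fin 5 × Fin 5 => dpt S b G p ik i₀ = v ∧ wtPrefix (dpt S b G p ik) g.val % p = w
      ∧ walkExp (dpt S b G p ik) g.val % 3 ≠ e).card) := by
  classical
  have hcard : S.card = 4 * p + 2 := by rw [← Nf_card S (le_of_eq hG6.symm), hGst 6 le_rfl]; rfl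
  set j : ℕ := Nf S g.val with hj
  have hjle : j ≤ 4 * p + 2 := by rw [← hcard, hj, ← Nf_card S (le_refl n)]; exact Nf_mono S (Nat.lt_succ_iff.mp g.isLt)
  have hW : ∀ ik, wtPrefix (dpt S b G p ik) g.val = Bfro S b g.val + AA p j ik := fun ik => by
    rw [wtPrefix_dpt_eq S b G p hG0 hGmono hG6 hGst ik g.val, W6_eq_AA hjle]
  have hWn : ∀ ik : Fin 5 × Fin 5, wt (dpt S b G p ik) = Bfro S b n + (TT p ik.1 + TT p ik.2) := fun ik => by
    rw [Summit.QuantumAdvantage.AdviceFreeQNC0.TransferWalk.wt_eq_wtPrefix, wtPrefix_dpt_eq S b G p hG0 hGmono hG6 hGst ik n, Nf_card S (le_refl n), hcard,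
      W6_eq_AA (le_refl _), AA_top]
  have hsel : ∀ ik, dpt S b G p ik i₀ = bit6 p ik (blkOf G i₀) := fun ik => by simp [dpt, hi₀]
  have hset : (univ.filter fun ik : Fin 5 × Fin 5 => dpt S b G p ik i₀ = v ∧ wtPrefix (dpt S b G p ik) g.val % p = w
      ∧ walkExp (dpt S b G p ik) g.val % 3 ≠ e)
      = (univ.filter fun ik : Fin 5 × Fin 5 => bit6 p ik (blkOf G i₀) = v).filter fun ik =>
          (AA p j ik + Bfro S b g.val) % p = w ∧
            (TT p ik.1 + TT p ik.2 + AA p j ik + (Bfro S b n + Bfro S b g.val)) % 3 ≠ e % 3 := by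
    ext ik
    simp only [mem_filter, mem_univ, true_and, hsel, walkExp, hWn, hW, Nat.mod_eq_of_lt he]
    constructor
    · rintro ⟨h1, h2, h3⟩
      refine ⟨h1, by rwa [add_comm] at h2, by omega⟩
    · rintro ⟨h1, h2, h3⟩
      refine ⟨h1, by rwa [add_comm] at h2, by omega⟩
  rw [hset, card_filter]
  exact certF hp j (by omega) (blkOf G i₀) (blkOf_lt G i₀) v (Bfro S b g.val) (Bfro S b n + Bfro S b g.val) w e

/-- **THE ONE-READ KERNEL, PROVED** at `K₀ = 4p+2` free bits for every `p ≢ 0 (mod 3)`: every prefix-counter junta strategy loses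
some point of every fibre over every one-read set of exactly `4p+2` positions. -/
theorem noPerfectOneRead_cert {p : ℕ} (hp : p % 3 ≠ 0) :
    ∀ (n c : ℕ) (D : JLinData p n), (∀ g, ∃ t : ZMod p, D.a g = fun i => if i.val < g.val then t else 0) →
      ∀ S : Finset (Fin n), (∀ g, (D.J g ∩ S).card ≤ 1) → S.card = 4 * p + 2 → ∀ b : Fin n → Bool,
        ∃ u : Fin n → Bool, ringWinU c D.strat (subcubeMerge (univ \ S) b u) = false := by
  classical
  intro n c D hpre S hS hcard b
  have hp0 : 0 < p := Nat.pos_of_ne_zero (by rintro rfl; simp at hp)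
  have hN : Nf S n = 4 * p + 2 := by rw [Nf_card S (le_refl n), hcard]
  obtain ⟨g₁, hg₁n, hg₁⟩ := Nf_hits S n p (by omega)
  obtain ⟨g₂, hg₂n, hg₂⟩ := Nf_hits S n (2 * p) (by omega)
  obtain ⟨g₃, hg₃n, hg₃⟩ := Nf_hits S n (2 * p + 1) (by omega)
  obtain ⟨g₄, hg₄n, hg₄⟩ := Nf_hits S n (3 * p + 1) (by omega)
  obtain ⟨g₅, hg₅n, hg₅⟩ := Nf_hits S n (4 * p + 1) (by omega)
  let G : ℕ → ℕ := fun k => if k = 0 then 0 else if k = 1 then g₁ else if k = 2 then g₂ else if k = 3 then g₃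
    else if k = 4 then g₄ else if k = 5 then g₅ else n
  have hG0 : G 0 = 0 := by simp [G]
  have hG6 : G 6 = n := by simp [G]
  have hGst : ∀ k ≤ 6, Nf S (G k) = st p k := by
    intro k hk
    interval_cases k <;> simp [G, st, Nf_zero, hg₁, hg₂, hg₃, hg₄, hg₅, hN]
  have hGmono : ∀ k ≤ 5, G k ≤ G (k + 1) := by
    intro k hk
    rcases Nat.eq_zero_or_pos k with rfl | hk1
    · simp [G]
    by_cases hk5 : k = 5
    · subst hk5; simpa [G] using hg₅n
    by_contra hlt
    have hmono := Nf_mono S (le_of_lt (not_le.mp hlt))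
    rw [hGst k (by omega), hGst (k + 1) (by omega)] at hmono
    interval_cases k <;> simp [st] at hmono <;> omega
  set x : Fin 5 × Fin 5 → (Fin n → Bool) := dpt S b G p with hx
  have hxS : ∀ ik, ∀ j, j ∉ S → x ik j = b j := fun ik j hj => by simp [hx, dpt, hj]
  have hSne : S.Nonempty := by rw [← card_pos, hcard]; omega
  have hodd : Odd (Fintype.card (Fin 5 × Fin 5)) := by
    rw [Fintype.card_prod, Fintype.card_fin]; exact ⟨12, by norm_num⟩
  obtain ⟨ik, hik⟩ := exists_loser_of_even_cuts c D.strat x hodd (fun g => by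
    obtain ⟨t, ht⟩ := hpre g
    obtain ⟨i₀, hi₀S, hJ⟩ : ∃ i₀ ∈ S, D.J g ∩ S ⊆ {i₀} := by
      rcases (D.J g ∩ S).eq_empty_or_nonempty with h0 | ⟨i₀, hi₀⟩
      · obtain ⟨i₀, hi₀⟩ := hSne
        exact ⟨i₀, hi₀, by rw [h0]; exact empty_subset _⟩
      · exact ⟨i₀, (mem_inter.mp hi₀).2, fun a ha => mem_singleton.mpr (card_le_one.mp (hS g) a ha i₀ hi₀)⟩
    exact even_fired_live hp0 D g t ht S i₀ hJ b x hxS c (fun v w e he =>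
      design_bal hp S b G hG0 hGmono hG6 hGst g i₀ hi₀S v w e he))
  refine ⟨x ik, ?_⟩
  have hm : subcubeMerge (univ \ S) b (x ik) = x ik := by
    funext i
    by_cases hi : i ∈ S
    · simp [subcubeMerge, hi]
    · simp [subcubeMerge, hi, hxS ik i hi]
  rw [hm]; exact hik
end Design

end PrefixFace

/-! ### THE PREFIX FACE AND THE SUFFIX FACE, CLOSED -/

section Finals

/-- **THE PREFIX FACE, uniform form** (every `p` with `3 ∤ p`): `log₂ n`-junta ⊕ PREFIX-counter strategies win on at most `θ·2ⁿ`
inputs, `θ = 1 − 2^{−(4p+2)}`, `n ≥ 2^{6(4p+2)+10}`, every charge.  Supersedes `prefixOneRead_hard_unif` (`(D.J g).card ≤ 1`,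
`θ = 5/6`) in the junta parameter. -/
theorem prefixForm_hard_unif {p : ℕ} (hp : p % 3 ≠ 0) :
    ∃ θ : ℝ, θ < 1 ∧ ∃ n₀ : ℕ, ∀ n ≥ n₀, ∀ (c : ℕ) (D : JLinData p n),
      (∀ g, (D.J g).card ≤ Nat.log 2 n) →
      (∀ g, ∃ t : ZMod p, D.a g = fun i => if i.val < g.val then t else 0) →
      (winCount c D.strat : ℝ) ≤ θ * (2 : ℝ) ^ n :=
  PrefixFace.winBound_of_noPerfect (PrefixFace.noPerfectOneRead_cert hp)

/-- the same for a prime `p ≠ 3` (the tree's hypothesis style). -/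
theorem prefixForm_hard_unif_prime {p : ℕ} [hpr : Fact p.Prime] (hp3 : p ≠ 3) :
    ∃ θ : ℝ, θ < 1 ∧ ∃ n₀ : ℕ, ∀ n ≥ n₀, ∀ (c : ℕ) (D : JLinData p n),
      (∀ g, (D.J g).card ≤ Nat.log 2 n) →
      (∀ g, ∃ t : ZMod p, D.a g = fun i => if i.val < g.val then t else 0) →
      (winCount c D.strat : ℝ) ≤ θ * (2 : ℝ) ^ n :=
  prefixForm_hard_unif fun h =>
    hp3 ((Nat.prime_dvd_prime_iff_eq Nat.prime_three hpr.out).mp (Nat.dvd_of_mod_eq_zero h)).symm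

/-- **THE SUFFIX FACE** (forms `t·𝟙_{[g,n)}`), by the landed time reversal `CharDialReversal` (`winCount_rev`, `card_J_rev`,
`rev_prefix_of_suffix`). -/
theorem suffixForm_hard_unif {p : ℕ} (hp : p % 3 ≠ 0) :
    ∃ θ : ℝ, θ < 1 ∧ ∃ n₀ : ℕ, ∀ n ≥ n₀, ∀ (c : ℕ) (D : JLinData p n),
      (∀ g, (D.J g).card ≤ Nat.log 2 n) →
      (∀ g, ∃ t : ZMod p, D.a g = fun i => if g.val ≤ i.val then t else 0) →
      (winCount c D.strat : ℝ) ≤ θ * (2 : ℝ) ^ n := by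
  obtain ⟨θ, hθ, n₀, H⟩ := prefixForm_hard_unif hp
  refine ⟨θ, hθ, n₀, fun n hn c D hJ hsuf => ?_⟩
  have h := H n hn (2 * c + 2 * n) D.rev (fun g => by rw [card_J_rev]; exact hJ _) (rev_prefix_of_suffix D hsuf)
  rwa [winCount_rev] at h

end Finals

end Summit.QuantumAdvantage.AdviceFreeQNC0.JLinPeel
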